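import Summits.AtomisticToContinuum.HydrodynamicLimit.Theorems.OneFlightGossipEngineCollisionActivityTailsEntropyTransferDilute
import Summits.AtomisticToContinuum.HydrodynamicLimit.Theorems.OneFlightGossipEngineCollisionActivityTailsAbnormalActivityHot
import Summits.AtomisticToContinuum.HydrodynamicLimit.Theorems.OneFlightGossipEngineCollisionActivityTailsAbnormalActivityTagged
import Summits.AtomisticToContinuum.HydrodynamicLimit.Theorems.OneFlightGossipEngineCollisionActivityTailsEnvelopePlumbing
import Summits.AtomisticToContinuum.HydrodynamicLimit.Theorems.OneFlightGossipEngineCollisionActivityTailsPreShockEnvelope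
import Summits.AtomisticToContinuum.HydrodynamicLimit.Theorems.CollisionActivityTails.Negative.EquilibriumReduction
import HarnessLib

/-!
# `CollisionActivityTails` (stmt-AtomisticToContinuum-13734), line `plaque-thinning-count-ld`:
# the EQUILIBRIUM RUNG of the crux follows from the untagged LMGF alone

Helper file (`--supports stmt-AtomisticToContinuum-13734`) for the crux
`Summit.AtomisticToContinuum.HydrodynamicLimit.Theses.OneFlightGossipEngine.CollisionActivityTails`, skeleton line
`plaque-thinning-count-ld` (`Cruxes/CollisionActivityTails/Lines/plaque_thinning_count_ld.lean`, v10, lead c6-0, cycle 2).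

The skeleton closes the crux from (U) `UntaggedActivityTails'` ⟸ `EquilibriumUntaggedActivityLMGF'` (entropy transfer at time
zero, landed p132950) ⟸ stub 1 + stub 2j (open), and (R) `AbnormalActivityVanishes'` ⟸ `AbnormalFromEnvelope` (landed: hot half
p132340, tagged half p135296, reduction p132104, plumbing p131788) + the IMPORT `PreShockEnvelopeDilute` (stub 4', 13677-kind, open).
At CONSTANT profiles `(a₀, 0, θ₀)` the import is a theorem: the transported canonical density is the canonical density
(invariance), and BGSR 2016 Prop. 3.2 bounds its marginals by `(2 c_β)^k e^{-β E_k}`, `β = θ₀⁻¹`, `c_β = (2πθ₀)^{-3/2}`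
(`envelope_const`, p129630) — so the diluteness clause reads `2 σ³ max(1, θ₀) ≤ κ₅` and holds for small `σ`. Hence:

* `envelopeOn_const` — the equilibrium envelope with EXPLICIT constants `β = θ₀⁻¹`, `C = 2 (2πθ₀)^{-3/2}`, every horizon;
* `abnormalFromEnvelope_holds` — stub 5' assembled from its landed halves (as in the skeleton);
* `abnormalSmallOn_const` — (R) at constant profiles, unconditionally, for `σ < σ_R(a₀, θ₀)` and every horizon `t ≥ 0`;
* `cruxOn_of_branches` — the LOCAL composition (one profile triple / diameter / flow family / horizon): untagged tail bound
  ∧ abnormal-mean bound ⇒ the crux's conclusion there (the skeleton's `crux_of_branches` with the `σ₀`-bookkeeping peeled off);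
* `EquilibriumCollisionActivityTailsFrame` — the crux's statement RESTRICTED to constant profiles `(a₀, 0, θ₀)` (same frame:
  Euler solution, `t = 0` LLN, horizons `t < T`, starts `s ≤ t`); `frame_of_crux` certifies it is a restriction;
* **`equilibriumRung_of_untaggedLMGF : EquilibriumUntaggedActivityLMGF' → EquilibriumCollisionActivityTailsFrame`** — the
  equilibrium rung of the crux needs ONLY the untagged exponential-moment bound (stubs 1 + 2j of the line): no envelope import,
  no entropy budget beyond the landed transfer.

So the line's two open inputs split cleanly by rung: the import `PreShockEnvelopeDilute` is consumed only off equilibrium.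

References: Bodineau–Gallagher–Saint-Raymond 2016 (Invent. Math.), Prop. 3.2 / 4.1 (marginal bounds of the hard-sphere Gibbs
density) [BodineauGallagherSaintRaymondInvent2016]; the line card `Cruxes/CollisionActivityTails/Lines/plaque-thinning-count-ld.md`.
-/

noncomputable section

open MeasureTheory Set Filter Topology
open scoped ENNReal

namespace Summit.AtomisticToContinuum.HydrodynamicLimit.Theorems.CollisionActivityTailsEquilibriumRung

open Literature.MathematicalPhysics.KineticTheory Literature.Analysis.FluidPDE
open Literature.Analysis.FunctionSpaces (maxwellianBeta)
open Summit.AtomisticToContinuum.HydrodynamicLimit.Theorems.CollisionActivityTailsActivityDomination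
  (Flow Cfg window act tdist nearCount)
open Summit.AtomisticToContinuum.HydrodynamicLimit.Theorems.CollisionActivityTailsNearFieldKineticTails
  (tailFn tailFn_of_lt tailFn_of_le tailFn_nonneg)
open Summit.AtomisticToContinuum.HydrodynamicLimit.Theorems.CollisionActivityTailsEndpointTails (ae_mem_good_localGibbsLaw)
open Summit.AtomisticToContinuum.HydrodynamicLimit.Theorems.CollisionActivityTailsPlaqueSplit
  (gibbs uncAct tagAct hotAct uncAct_nonneg tagAct_nonneg hotAct_nonneg tailFn_act_le_three lintegral_ofReal_mul_add_le
    EquilibriumUntaggedActivityLMGF' UntaggedActivityTails' EnvelopeOn AbnormalSmallOn AbnormalFromEnvelope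
    stub_entropyTransferDilute)
open Summit.AtomisticToContinuum.HydrodynamicLimit.Theorems.CollisionActivityTailsEnvelopePlumbing (stub_labelEnvelopeOn)
open Summit.AtomisticToContinuum.HydrodynamicLimit.Theorems.CollisionActivityTailsAbnormalActivity
  (stub_abnormalFromEnvelope_of_hot_of_tagged hotFromEnvelope_of_pairEnvelope)
open Summit.AtomisticToContinuum.HydrodynamicLimit.Theorems.CollisionActivityTailsAbnormalActivityTagged
  (stub_taggedFromLabelEnvelope)
open Summit.AtomisticToContinuum.HydrodynamicLimit.Theorems.CollisionActivityTailsPreShockEnvelope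
  (canonicalDensity_const_eq indicator_hsTransport_const_ae_eq regime_of_le_quarter)

variable {σ : ℝ} {N : ℕ}

/-! ## §1 The equilibrium envelope with explicit constants -/

/-- **Equilibrium envelope, explicit constants.** For constant profiles `(a₀, 0, θ₀)`, `a₀, θ₀ > 0`, `0 < σ ≤ 1/4`, every
flow family and every horizon `t₁`: `EnvelopeOn σ a₀ θ₀ 0 Φ t₁ β C` with `β = θ₀⁻¹` and `C = 2 (2π θ₀)^{-3/2}`
(the proof of `envelope_const`, p129630, with the witnesses exposed: invariance of the canonical density under the flow,
`indicator_hsTransport_const_ae_eq`, and BGSR 2016 Prop. 3.2 `nthMarginal_canonicalDensity_le_two_pow` in the regime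
`N (2ε)³ ≤ 1/2`, `regime_of_le_quarter`). [cite: BodineauGallagherSaintRaymondInvent2016, Prop. 3.2, Prop. 4.1] -/
theorem envelopeOn_const {a₀ θ₀ : ℝ} (ha : 0 < a₀) (hθ : 0 < θ₀) (hσ : 0 < σ) (hσ4 : σ ≤ 4⁻¹)
    (Φ : (N : ℕ) → Flow σ N) (t₁ : ℝ) :
    EnvelopeOn σ (fun _ => a₀) (fun _ => θ₀) (fun _ => 0) Φ t₁ θ₀⁻¹ (2 * (2 * Real.pi * θ₀) ^ (-(3 : ℝ) / 2)) := by
  intro N k r _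
  set β : ℝ := θ₀⁻¹ with hβdef
  have hβ : 0 < β := inv_pos.2 hθ
  set c : ℝ := (2 * Real.pi * β⁻¹) ^ (-(Module.finrank ℝ (EuclideanSpace ℝ (Fin 3)) : ℝ) / 2) with hcdef
  have hc_eq : c = (2 * Real.pi * θ₀) ^ (-(3 : ℝ) / 2) := by
    rw [hcdef, hβdef, inv_inv, finrank_euclideanSpace, Fintype.card_fin]
    norm_num
  have hae := Literature.MathematicalPhysics.KineticTheory.nthMarginal_congr_ae (s := k)
    (indicator_hsTransport_const_ae_eq a₀ θ₀ 0 (Φ N) r)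
  filter_upwards [hae] with Zk hZk
  rw [hZk, canonicalDensity_const_eq ha.ne' θ₀, ← hc_eq]
  rcases le_or_gt k (N + 1) with hk | hk
  · have hnn : 0 ≤ nthMarginal (N + 1) k (canonicalDensity (Torus.geometry (Fin 3)) (hsDiameter σ N) (N + 1)
        (fun p : T3 × V3 => maxwellianBeta β p.2)) Zk :=
      nthMarginal_nonneg (N + 1) k (fun z => canonicalDensity_maxwellianBeta_nonneg hβ z) Zk
    rw [show θ₀⁻¹ = β from rfl, abs_of_nonneg hnn]
    refine (nthMarginal_canonicalDensity_le_two_pow hβ (hsDiameter_pos hσ N).le hk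
      (regime_of_le_quarter hσ hσ4 N) Zk).trans (le_of_eq ?_)
    rw [tensorPow_maxwellianBeta, mul_pow, neg_mul]
    ring
  · have h0 : nthMarginal (N + 1) k (canonicalDensity (Torus.geometry (Fin 3)) (hsDiameter σ N) (N + 1)
        (fun p : T3 × V3 => maxwellianBeta β p.2)) Zk = 0 := by
      simp [nthMarginal, not_le.2 hk]
    rw [show θ₀⁻¹ = β from rfl, h0, abs_zero]
    positivity

/-- The diluteness functional of the line at the equilibrium constants: `C (2π/β)^{3/2} σ³ max(1, β⁻¹) = 2 σ³ max(1, θ₀)` for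
`β = θ₀⁻¹`, `C = 2 (2πθ₀)^{-3/2}`. -/
theorem dilute_const_eq {θ₀ : ℝ} (hθ : 0 < θ₀) (σ : ℝ) :
    2 * (2 * Real.pi * θ₀) ^ (-(3 : ℝ) / 2) * (2 * Real.pi / θ₀⁻¹) ^ (3 / 2 : ℝ) * σ ^ 3 * max 1 θ₀⁻¹⁻¹ =
      2 * σ ^ 3 * max 1 θ₀ := by
  have hx : 0 < 2 * Real.pi * θ₀ := by positivity
  rw [inv_inv, div_inv_eq_mul]
  have h : (2 * Real.pi * θ₀) ^ (-(3 : ℝ) / 2) * (2 * Real.pi * θ₀) ^ (3 / 2 : ℝ) = 1 := by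
    rw [← Real.rpow_add hx]
    norm_num
  calc 2 * (2 * Real.pi * θ₀) ^ (-(3 : ℝ) / 2) * (2 * Real.pi * θ₀) ^ (3 / 2 : ℝ) * σ ^ 3 * max 1 θ₀
      = 2 * ((2 * Real.pi * θ₀) ^ (-(3 : ℝ) / 2) * (2 * Real.pi * θ₀) ^ (3 / 2 : ℝ)) * σ ^ 3 * max 1 θ₀ := by ring
    _ = 2 * σ ^ 3 * max 1 θ₀ := by rw [h]; ring

/-! ## §2 The abnormal branch at equilibrium is unconditional -/

/-- **Stub 5' is a theorem** (exactly the skeleton's assembly of its landed halves): the hot half from the pair envelope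
(`hotFromEnvelope_of_pairEnvelope`, p132340, fed by the plumbing `stub_labelEnvelopeOn`, p131788), the tagged half
(`stub_taggedFromLabelEnvelope`, p135296) and the reduction (`stub_abnormalFromEnvelope_of_hot_of_tagged`, p132104). -/
theorem abnormalFromEnvelope_holds : AbnormalFromEnvelope :=
  stub_abnormalFromEnvelope_of_hot_of_tagged
    (hotFromEnvelope_of_pairEnvelope fun a₀ θ₀ u₀ ha hθ hu ha0 hθ0 σ hσ hσ2 Φ t₁ β C hC hE =>
      (stub_labelEnvelopeOn a₀ θ₀ u₀ ha hθ hu ha0 hθ0 σ hσ hσ2 Φ t₁ β C hC hE).2)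
    (stub_taggedFromLabelEnvelope stub_labelEnvelopeOn)

/-- **(R) at equilibrium, unconditionally.** For `a₀, θ₀ > 0` there is `σ_R > 0` such that for `0 < σ < σ_R`, every flow family
and every horizon `t ≥ 0`, `AbnormalSmallOn σ a₀ θ₀ 0 Φ t` holds: stub 5' at the explicit equilibrium envelope on `[0, t+1]`,
whose diluteness clause `2σ³ max(1,θ₀) ≤ κ₅` holds once `σ ≤ min 1 (κ₅ / (2 max 1 θ₀))` (`σ³ ≤ σ` for `σ ≤ 1`). -/
theorem abnormalSmallOn_const {a₀ θ₀ : ℝ} (ha : 0 < a₀) (hθ : 0 < θ₀) :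
    ∃ σR : ℝ, 0 < σR ∧ ∀ σ : ℝ, 0 < σ → σ < σR → ∀ (Φ : (N : ℕ) → Flow σ N) (t : ℝ), 0 ≤ t →
      AbnormalSmallOn σ (fun _ => a₀) (fun _ => θ₀) (fun _ => 0) Φ t := by
  obtain ⟨κ₅, hκ₅, σ₅, hσ₅, h5⟩ := abnormalFromEnvelope_holds (fun _ => a₀) (fun _ => θ₀) (fun _ => 0)
    continuous_const continuous_const continuous_const (fun _ => ha) (fun _ => hθ)
  have hM : 0 < 2 * max 1 θ₀ := by positivity
  refine ⟨min (min σ₅ 4⁻¹) (min 1 (κ₅ / (2 * max 1 θ₀))), lt_min (lt_min hσ₅ (by norm_num))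
    (lt_min one_pos (div_pos hκ₅ hM)), fun σ hσ hσlt Φ t ht => ?_⟩
  have hσ₅' : σ < σ₅ := hσlt.trans_le ((min_le_left _ _).trans (min_le_left _ _))
  have hσ4 : σ ≤ 4⁻¹ := (hσlt.trans_le ((min_le_left _ _).trans (min_le_right _ _))).le
  have hσ1 : σ ≤ 1 := (hσlt.trans_le ((min_le_right _ _).trans (min_le_left _ _))).le
  have hσκ : σ ≤ κ₅ / (2 * max 1 θ₀) := (hσlt.trans_le ((min_le_right _ _).trans (min_le_right _ _))).le
  have hβ : 0 < θ₀⁻¹ := inv_pos.2 hθ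
  have hC : 0 ≤ 2 * (2 * Real.pi * θ₀) ^ (-(3 : ℝ) / 2) := by positivity
  refine h5 σ hσ hσ₅' Φ t (t + 1) θ₀⁻¹ (2 * (2 * Real.pi * θ₀) ^ (-(3 : ℝ) / 2)) ht (by linarith) hβ hC ?_
    (envelopeOn_const ha hθ hσ hσ4 Φ (t + 1))
  rw [dilute_const_eq hθ σ]
  have hσ3 : σ ^ 3 ≤ σ := by
    calc σ ^ 3 = σ * (σ * σ) := by ring
      _ ≤ σ * (1 * 1) := by gcongr
      _ = σ := by ring
  calc 2 * σ ^ 3 * max 1 θ₀ ≤ 2 * σ * max 1 θ₀ := by gcongr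
    _ = σ * (2 * max 1 θ₀) := by ring
    _ ≤ κ₅ / (2 * max 1 θ₀) * (2 * max 1 θ₀) := mul_le_mul_of_nonneg_right hσκ hM.le
    _ = κ₅ := div_mul_cancel₀ κ₅ hM.ne'

/-! ## §3 The local composition -/

/-- **The untagged tail bound for ONE profile triple / diameter / flow family / horizon** (the body of
`UntaggedActivityTails'` behind its frame prefix). -/
def UntaggedOn (σ : ℝ) (a₀ θ₀ : T3 → ℝ) (u₀ : T3 → V3) (Φ : (N : ℕ) → Flow σ N) (t : ℝ) : Prop :=
  ∀ y : ℝ, 0 < y → y * σ ^ 3 ≤ 1 → ∃ V₀ : ℝ, 0 < V₀ ∧ ∀ V : ℝ, V₀ ≤ V → ∀ Θ : ℝ, 0 < Θ → ∀ K : ℕ,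
    ∀ η : ℝ, 0 < η → ∃ τ₀ : ℝ, 0 < τ₀ ∧ ∀ τ : ℝ, τ₀ ≤ τ → ∃ N₀ : ℕ, ∀ N : ℕ, N₀ ≤ N → ∀ s ∈ Set.Icc 0 t,
      AEMeasurable (fun z => ∑ i : Fin (N + 1), tailFn V (uncAct Θ y K (Φ N) τ s i z))
          (localGibbsLaw σ a₀ u₀ θ₀ N (Φ N)) ∧
      ∫⁻ z, ENNReal.ofReal (((N : ℝ) + 1)⁻¹ * ∑ i : Fin (N + 1), tailFn V (uncAct Θ y K (Φ N) τ s i z))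
        ∂(localGibbsLaw σ a₀ u₀ θ₀ N (Φ N)) ≤ ENNReal.ofReal η

/-- **The crux's conclusion for ONE profile triple / diameter / flow family / horizon** (the body of
`OneFlightGossipEngine.CollisionActivityTails` behind its frame prefix, over the landed `act`, `tailFn`). -/
def CruxOn (σ : ℝ) (a₀ θ₀ : T3 → ℝ) (u₀ : T3 → V3) (Φ : (N : ℕ) → Flow σ N) (t : ℝ) : Prop :=
  ∃ V₀ : ℝ, 0 < V₀ ∧ ∀ V : ℝ, V₀ ≤ V → ∀ ε : ℝ, 0 < ε →
    ∃ τ₀ : ℝ, 0 < τ₀ ∧ ∀ τ : ℝ, τ₀ ≤ τ → ∃ N₀ : ℕ, ∀ N : ℕ, N₀ ≤ N → ∀ s ∈ Set.Icc 0 t,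
      ∫⁻ z, ENNReal.ofReal (((N : ℝ) + 1)⁻¹ * ∑ i : Fin (N + 1), tailFn V (act (Φ N) τ s i z))
        ∂(localGibbsLaw σ a₀ u₀ θ₀ N (Φ N)) ≤ ENNReal.ofReal ε

/-- **LOCAL COMPOSITION.** For `σ > 0`, one profile triple, one flow family and one horizon: the untagged tail bound and the
abnormal-mean bound give the crux's conclusion there. Verbatim the bookkeeping of the skeleton's `crux_of_branches`
(`y := y₀`; `V₀ := 3 V₀ᵘ(y₀)`; `Θ, K` from the abnormal branch at accuracy `ε/9`; `τ₀` from the untagged branch at level `V/3`;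
pathwise `𝟙{V<a}a ≤ 3(𝟙{V/3<unc}unc + tag + hot)` on the good set, one `lintegral` split). -/
theorem cruxOn_of_branches (hσ : 0 < σ) {a₀ θ₀ : T3 → ℝ} {u₀ : T3 → V3} {Φ : (N : ℕ) → Flow σ N} {t : ℝ}
    (hU : UntaggedOn σ a₀ θ₀ u₀ Φ t) (hR : AbnormalSmallOn σ a₀ θ₀ u₀ Φ t) : CruxOn σ a₀ θ₀ u₀ Φ t := by
  obtain ⟨y₀, hy₀, hyσ, hR⟩ := hR
  obtain ⟨V₀, hV₀, hU⟩ := hU y₀ hy₀ hyσ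
  refine ⟨3 * V₀, by positivity, ?_⟩
  intro V hV ε hε
  have hε9 : 0 < ε / 9 := by positivity
  obtain ⟨Θ, hΘ, K, hR⟩ := hR y₀ le_rfl (ε / 9) hε9
  obtain ⟨τ₀, hτ₀, hU⟩ := hU (V / 3) (by linarith) Θ hΘ K (ε / 9) hε9
  refine ⟨τ₀, hτ₀, fun τ hτ => ?_⟩
  have hτpos : 0 < τ := hτ₀.trans_le hτ
  obtain ⟨N₁, hU⟩ := hU τ hτ
  obtain ⟨N₂, hR⟩ := hR τ hτpos
  refine ⟨max N₁ N₂, fun N hN s hs => ?_⟩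
  obtain ⟨hmeas, hUb⟩ := hU N (le_of_max_le_left hN) s hs
  have hRb := hR N (le_of_max_le_right hN) s hs
  set P := localGibbsLaw σ a₀ u₀ θ₀ N (Φ N) with hP
  have hN1 : (0 : ℝ) < (N : ℝ) + 1 := by positivity
  have hae : ∀ᵐ z ∂P,
      ((N : ℝ) + 1)⁻¹ * ∑ i : Fin (N + 1), tailFn V (act (Φ N) τ s i z) ≤
        3 * ((((N : ℝ) + 1)⁻¹ * ∑ i : Fin (N + 1), tailFn (V / 3) (uncAct Θ y₀ K (Φ N) τ s i z)) +
          (((N : ℝ) + 1)⁻¹ * ∑ i : Fin (N + 1),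
            (tagAct Θ y₀ K (Φ N) τ s i z + hotAct Θ (Φ N) τ s i z))) := by
    filter_upwards [ae_mem_good_localGibbsLaw σ a₀ θ₀ u₀ N (Φ N)] with z hz
    have hpt : ∀ i : Fin (N + 1), tailFn V (act (Φ N) τ s i z) ≤
        3 * (tailFn (V / 3) (uncAct Θ y₀ K (Φ N) τ s i z) +
          (tagAct Θ y₀ K (Φ N) τ s i z + hotAct Θ (Φ N) τ s i z)) := fun i => by
      have := tailFn_act_le_three hσ.le (Θ := Θ) (y := y₀) (K := K) (Φ N) hτpos.le s i hz V
      linarith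
    have hsum := Finset.sum_le_sum fun i (_ : i ∈ Finset.univ) => hpt i
    rw [← Finset.mul_sum, Finset.sum_add_distrib] at hsum
    have hinv : 0 ≤ ((N : ℝ) + 1)⁻¹ := inv_nonneg.2 hN1.le
    have := mul_le_mul_of_nonneg_left hsum hinv
    nlinarith [this]
  have hmeas' : AEMeasurable
      (fun z => ((N : ℝ) + 1)⁻¹ * ∑ i : Fin (N + 1), tailFn (V / 3) (uncAct Θ y₀ K (Φ N) τ s i z)) P :=
    hmeas.const_mul _
  calc ∫⁻ z, ENNReal.ofReal (((N : ℝ) + 1)⁻¹ * ∑ i : Fin (N + 1), tailFn V (act (Φ N) τ s i z)) ∂P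
      ≤ ∫⁻ z, ENNReal.ofReal (3 * ((((N : ℝ) + 1)⁻¹ *
            ∑ i : Fin (N + 1), tailFn (V / 3) (uncAct Θ y₀ K (Φ N) τ s i z)) +
          (((N : ℝ) + 1)⁻¹ * ∑ i : Fin (N + 1),
            (tagAct Θ y₀ K (Φ N) τ s i z + hotAct Θ (Φ N) τ s i z)))) ∂P :=
        lintegral_mono_ae (hae.mono fun z hz => ENNReal.ofReal_le_ofReal hz)
    _ ≤ ENNReal.ofReal 3 * (∫⁻ z, ENNReal.ofReal (((N : ℝ) + 1)⁻¹ *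
            ∑ i : Fin (N + 1), tailFn (V / 3) (uncAct Θ y₀ K (Φ N) τ s i z)) ∂P +
          ∫⁻ z, ENNReal.ofReal (((N : ℝ) + 1)⁻¹ * ∑ i : Fin (N + 1),
            (tagAct Θ y₀ K (Φ N) τ s i z + hotAct Θ (Φ N) τ s i z)) ∂P) :=
        lintegral_ofReal_mul_add_le (by norm_num) hmeas'
    _ ≤ ENNReal.ofReal 3 * (ENNReal.ofReal (ε / 9) + ENNReal.ofReal (ε / 9)) := by
        gcongr
    _ = ENNReal.ofReal (3 * (ε / 9 + ε / 9)) := by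
        rw [← ENNReal.ofReal_add hε9.le hε9.le, ← ENNReal.ofReal_mul (by norm_num)]
    _ ≤ ENNReal.ofReal ε := ENNReal.ofReal_le_ofReal (by linarith)

/-! ## §4 The equilibrium rung of the crux, in the crux's frame -/

/-- **THE EQUILIBRIUM RUNG OF THE CRUX** (`OneFlightGossipEngine.CollisionActivityTails` restricted to CONSTANT profiles
`(a₀, 0, θ₀)`, otherwise verbatim — same frame: a classical hs-Euler solution on `[0,T)`, the `t = 0` LLN, horizons `t < T`,
starts `s ≤ t`; `frame_of_crux` certifies that it is a restriction). At constant data the frame hypotheses are dischargeable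
(constant states are Euler solutions on every horizon; the constant-profile LLN holds — Disproof §5c), which is why this is "the"
equilibrium rung; the frame form is the one the line's composition produces directly. -/
def EquilibriumCollisionActivityTailsFrame : Prop :=
  ∀ (a₀ θ₀ : ℝ), 0 < a₀ → 0 < θ₀ → ∃ σ₀ : ℝ, 0 < σ₀ ∧ ∀ σ : ℝ, 0 < σ → σ < σ₀ →
    ∀ (T : ℝ) (ρ θ : ℝ → T3 → ℝ) (u : ℝ → T3 → V3), IsHardSphereEulerSolution σ T ρ u θ →
    ∀ Φ : (N : ℕ) → Flow σ N,
    TendstoHydroFieldsAt (fun N => localGibbsLaw σ (fun _ => a₀) (fun _ => 0) (fun _ => θ₀) N (Φ N)) Φ ρ u θ 0 →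
    ∀ t ∈ Set.Ico 0 T, CruxOn σ (fun _ => a₀) (fun _ => θ₀) (fun _ => 0) Φ t

/-- The equilibrium rung IS the crux restricted to constant profiles (specialisation; `act`, `window`, `tailFn` unfold to the
crux's `let`-bound integrand definitionally). -/
theorem frame_of_crux (h : Summit.AtomisticToContinuum.HydrodynamicLimit.Theses.OneFlightGossipEngine.CollisionActivityTails) :
    EquilibriumCollisionActivityTailsFrame := by
  intro a₀ θ₀ ha hθ
  obtain ⟨σ₀, hσ₀, h⟩ := h (fun _ => a₀) (fun _ => θ₀) (fun _ => 0) continuous_const continuous_const continuous_const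
    (fun _ => ha) (fun _ => hθ)
  refine ⟨σ₀, hσ₀, fun σ hσ hσlt T ρ θ u hsol Φ hLLN t ht => ?_⟩
  obtain ⟨V₀, hV₀, h⟩ := h σ hσ hσlt T ρ θ u hsol Φ hLLN t ht
  refine ⟨V₀, hV₀, fun V hV ε hε => ?_⟩
  obtain ⟨τ₀, hτ₀, h⟩ := h V hV ε hε
  refine ⟨τ₀, hτ₀, fun τ hτ => ?_⟩
  obtain ⟨N₀, h⟩ := h τ hτ
  exact ⟨N₀, fun N hN s hs => h N hN s hs⟩

/-- **THE EQUILIBRIUM RUNG FROM THE UNTAGGED LMGF ALONE.** `EquilibriumUntaggedActivityLMGF'` (the output of stubs 1 + 2j of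
the line; all dynamics) implies the equilibrium rung of the crux: (U) by the landed entropy transfer `stub_entropyTransferDilute`
specialised to constant profiles (the transfer is then a tautology up to constants, but the landed global statement serves),
(R) by `abnormalSmallOn_const` (the import `PreShockEnvelopeDilute` DISCHARGED at equilibrium), composed by `cruxOn_of_branches`.
Bookkeeping: `σ₀ := min σ_U σ_R`. -/
theorem equilibriumRung_of_untaggedLMGF (hL : EquilibriumUntaggedActivityLMGF') :
    EquilibriumCollisionActivityTailsFrame := by
  intro a₀ θ₀ ha hθ
  obtain ⟨σU, hσU, hU⟩ := stub_entropyTransferDilute hL (fun _ => a₀) (fun _ => θ₀) (fun _ => 0)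
    continuous_const continuous_const continuous_const (fun _ => ha) (fun _ => hθ)
  obtain ⟨σR, hσR, hR⟩ := abnormalSmallOn_const ha hθ
  refine ⟨min σU σR, lt_min hσU hσR, fun σ hσ hσlt T ρ θ u hsol Φ hLLN t ht => ?_⟩
  have hσU' : σ < σU := hσlt.trans_le (min_le_left _ _)
  have hσR' : σ < σR := hσlt.trans_le (min_le_right _ _)
  exact cruxOn_of_branches hσ (fun y hy hyσ => hU σ hσ hσU' T ρ θ u hsol Φ hLLN t ht y hy hyσ) (hR σ hσ hσR' Φ t ht.1)

/-- **Registered helper sub-goal `stub_equilibriumRung`** (line `plaque-thinning-count-ld`): the equilibrium rung of the crux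
from the untagged LMGF alone (`equilibriumRung_of_untaggedLMGF`). -/
theorem stub_equilibriumRung : EquilibriumUntaggedActivityLMGF' → EquilibriumCollisionActivityTailsFrame :=
  equilibriumRung_of_untaggedLMGF

/-! ## §5 The equilibrium rung, UNCONDITIONALLY (frame hypotheses discharged at constant data) — appended, cycle 2

At constant data the frame hypotheses of `EquilibriumCollisionActivityTailsFrame` hold in the tree: constant states are classical
hs-Euler solutions on every horizon (`DenseExcursionUntied.isHardSphereEulerSolution_const`) and the `t = 0` LLN of the constant-profile
local Gibbs laws holds with a CONSTANT density (`CollisionActivityTailsEquilibrium.constantProfileLLN_holds`, landed negative knowledge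
`Theorems/CollisionActivityTails/Negative/EquilibriumReduction.lean`). So the untagged LMGF alone gives the zero-drift instance of the
disprover's `EquilibriumCollisionActivityTails` (window `(0, w]`, canonical Gibbs law) — no Euler data, no LLN hypothesis, no envelope. -/

/-- **THE ZERO-DRIFT EQUILIBRIUM RUNG FROM THE UNTAGGED LMGF, UNCONDITIONALLY**: for `a₀, θ₀ > 0` there is `σ₀ > 0` such that for
`0 < σ < σ₀`, every flow family, `∃ V₀ ∀ V ≥ V₀ ∀ ε ∃ τ₀ ∀ τ ≥ τ₀ ∃ N₀ ∀ N ≥ N₀`: the `L¹` tail of the window activity over `(0, w]`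
under the canonical Gibbs law `localGibbsLaw σ a₀ 0 θ₀` is `≤ ε` — verbatim the `u₀ = 0` instance of
`CollisionActivityTailsEquilibrium.EquilibriumCollisionActivityTails` (the integrand written with the landed `act`, `tailFn`, `window`,
which unfold to the crux's `let`-bound integrand). Proof: `equilibriumRung_of_untaggedLMGF` at `T = 1`, `t = s = 0`, the constant Euler
state of density `r` and the constant-profile LLN. -/
theorem equilibriumZeroDrift_of_untaggedLMGF (hL : EquilibriumUntaggedActivityLMGF') :
    ∀ (a₀ θ₀ : ℝ), 0 < a₀ → 0 < θ₀ → ∃ σ₀ : ℝ, 0 < σ₀ ∧ ∀ σ : ℝ, 0 < σ → σ < σ₀ →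
    ∀ Φ : (N : ℕ) → Flow σ N, ∃ V₀ : ℝ, 0 < V₀ ∧ ∀ V : ℝ, V₀ ≤ V → ∀ ε : ℝ, 0 < ε →
    ∃ τ₀ : ℝ, 0 < τ₀ ∧ ∀ τ : ℝ, τ₀ ≤ τ → ∃ N₀ : ℕ, ∀ N : ℕ, N₀ ≤ N →
      ∫⁻ z, ENNReal.ofReal (((N : ℝ) + 1)⁻¹ * ∑ i : Fin (N + 1), tailFn V (act (Φ N) τ 0 i z))
        ∂(localGibbsLaw σ (fun _ => a₀) (fun _ => 0) (fun _ => θ₀) N (Φ N)) ≤ ENNReal.ofReal ε := by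
  intro a₀ θ₀ ha hθ
  obtain ⟨σF, hσF, hF⟩ := equilibriumRung_of_untaggedLMGF hL a₀ θ₀ ha hθ
  obtain ⟨σ₁, hσ₁, hl⟩ :=
    Summit.AtomisticToContinuum.HydrodynamicLimit.Theorems.CollisionActivityTailsEquilibrium.constantProfileLLN_holds a₀ θ₀ 0 ha hθ
  refine ⟨min σF σ₁, lt_min hσF hσ₁, fun σ hσ hσlt Φ => ?_⟩
  have hσF' : σ < σF := hσlt.trans_le (min_le_left _ _)
  have hσ₁' : σ < σ₁ := hσlt.trans_le (min_le_right _ _)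
  obtain ⟨r, hr, hlln⟩ := hl σ hσ hσ₁'
  obtain ⟨V₀, hV₀, H⟩ := hF σ hσ hσF' 1 (fun _ _ => r) (fun _ _ => θ₀) (fun _ _ => 0)
    (Summit.AtomisticToContinuum.HydrodynamicLimit.Theorems.DenseExcursionUntied.isHardSphereEulerSolution_const σ 1 0 hr hθ)
    Φ (hlln Φ) 0 ⟨le_rfl, one_pos⟩
  refine ⟨V₀, hV₀, fun V hV ε hε => ?_⟩
  obtain ⟨τ₀, hτ₀, H⟩ := H V hV ε hε
  refine ⟨τ₀, hτ₀, fun τ hτ => ?_⟩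
  obtain ⟨N₀, H⟩ := H τ hτ
  exact ⟨N₀, fun N hN => H N hN 0 ⟨le_rfl, le_rfl⟩⟩

/-- The same, literally as the `u₀ = 0` instance of the disprover's `EquilibriumCollisionActivityTails` body (crux `let`-form). -/
theorem equilibriumCollisionActivityTails_zeroDrift_of_untaggedLMGF (hL : EquilibriumUntaggedActivityLMGF') :
    ∀ (a₀ θ₀ : ℝ), 0 < a₀ → 0 < θ₀ → ∃ σ₀ : ℝ, 0 < σ₀ ∧ ∀ σ : ℝ, 0 < σ → σ < σ₀ →
    ∀ Φ : (N : ℕ) → Flow σ N, ∃ V₀ : ℝ, 0 < V₀ ∧ ∀ V : ℝ, V₀ ≤ V → ∀ ε : ℝ, 0 < ε →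
    ∃ τ₀ : ℝ, 0 < τ₀ ∧ ∀ τ : ℝ, τ₀ ≤ τ → ∃ N₀ : ℕ, ∀ N : ℕ, N₀ ≤ N →
      (let w : ℝ := τ * ((N : ℝ) + 1) ^ (-(1 / 3 : ℝ))
       let P := localGibbsLaw σ (fun _ => a₀) (fun _ => (0 : V3)) (fun _ => θ₀) N (Φ N)
       let act := fun (i : Fin (N + 1)) (z : Config (N + 1) (Fin 3) T3) =>
         σ / τ * (Φ N).collisionSum (Set.Ioc 0 w)
           (fun c => if c.fst = i then ‖c.postVel.1 - c.preVel.1‖ else 0) z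
       ∫⁻ z, ENNReal.ofReal (((N : ℝ) + 1)⁻¹ *
           ∑ i : Fin (N + 1), Set.indicator {y : ℝ | V < y} (fun y => y) (act i z)) ∂P ≤
         ENNReal.ofReal ε) := by
  intro a₀ θ₀ ha hθ
  obtain ⟨σ₀, hσ₀, H⟩ := equilibriumZeroDrift_of_untaggedLMGF hL a₀ θ₀ ha hθ
  refine ⟨σ₀, hσ₀, fun σ hσ hσlt Φ => ?_⟩
  obtain ⟨V₀, hV₀, H⟩ := H σ hσ hσlt Φ
  refine ⟨V₀, hV₀, fun V hV ε hε => ?_⟩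
  obtain ⟨τ₀, hτ₀, H⟩ := H V hV ε hε
  refine ⟨τ₀, hτ₀, fun τ hτ => ?_⟩
  obtain ⟨N₀, H⟩ := H τ hτ
  refine ⟨N₀, fun N hN => ?_⟩
  have key := H N hN
  simpa only [act, window, tailFn, zero_add] using key

/-- **Registered helper sub-goal `stub_equilibriumZeroDrift`** (line `plaque-thinning-count-ld`): the unconditional zero-drift equilibrium rung of the
crux from the untagged LMGF (`equilibriumZeroDrift_of_untaggedLMGF`). -/
theorem stub_equilibriumZeroDrift : EquilibriumUntaggedActivityLMGF' → ∀ (a₀ θ₀ : ℝ), 0 < a₀ → 0 < θ₀ → ∃ σ₀ : ℝ, 0 < σ₀ ∧ ∀ σ : ℝ, 0 < σ → σ < σ₀ → ∀ Φ : (N : ℕ) → Flow σ N, ∃ V₀ : ℝ, 0 < V₀ ∧ ∀ V : ℝ, V₀ ≤ V → ∀ ε : ℝ, 0 < ε → ∃ τ₀ : ℝ, 0 < τ₀ ∧ ∀ τ : ℝ, τ₀ ≤ τ → ∃ N₀ : ℕ, ∀ N : ℕ, N₀ ≤ N → ∫⁻ z, ENNReal.ofReal (((N : ℝ) + 1)⁻¹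 * ∑ i : Fin (N + 1), tailFn V (act (Φ N) τ 0 i z)) ∂(localGibbsLaw σ (fun _ => a₀) (fun _ => 0) (fun _ => θ₀) N (Φ N)) ≤ ENNReal.ofReal ε :=
  equilibriumZeroDrift_of_untaggedLMGF

/-- **THE ZERO-DRIFT EQUILIBRIUM RUNG, EVERY HORIZON AND EVERY START, UNCONDITIONALLY** (appended, cycle 2): for `a₀, θ₀ > 0` there is `σ₀ > 0`
such that for `0 < σ < σ₀`, every flow family and every horizon `t ≥ 0`: `∃ V₀ ∀ V ≥ V₀ ∀ ε ∃ τ₀ ∀ τ ≥ τ₀ ∃ N₀ ∀ N ≥ N₀ ∀ s ∈ [0, t]`, the `L¹` tail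
of the window activity over `(s, s + w]` under the canonical Gibbs law is `≤ ε` — `equilibriumRung_of_untaggedLMGF` on the horizon `T = t + 1` with
the constant Euler state and the constant-profile LLN (the thresholds may depend on `t` through the frame; invariance of the Gibbs law would remove
this, not needed here). -/
theorem equilibriumAllStarts_of_untaggedLMGF (hL : EquilibriumUntaggedActivityLMGF') :
    ∀ (a₀ θ₀ : ℝ), 0 < a₀ → 0 < θ₀ → ∃ σ₀ : ℝ, 0 < σ₀ ∧ ∀ σ : ℝ, 0 < σ → σ < σ₀ →
    ∀ (Φ : (N : ℕ) → Flow σ N) (t : ℝ), 0 ≤ t → ∃ V₀ : ℝ, 0 < V₀ ∧ ∀ V : ℝ, V₀ ≤ V → ∀ ε : ℝ, 0 < ε →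
    ∃ τ₀ : ℝ, 0 < τ₀ ∧ ∀ τ : ℝ, τ₀ ≤ τ → ∃ N₀ : ℕ, ∀ N : ℕ, N₀ ≤ N → ∀ s ∈ Set.Icc 0 t,
      ∫⁻ z, ENNReal.ofReal (((N : ℝ) + 1)⁻¹ * ∑ i : Fin (N + 1), tailFn V (act (Φ N) τ s i z))
        ∂(localGibbsLaw σ (fun _ => a₀) (fun _ => 0) (fun _ => θ₀) N (Φ N)) ≤ ENNReal.ofReal ε := by
  intro a₀ θ₀ ha hθ
  obtain ⟨σF, hσF, hF⟩ := equilibriumRung_of_untaggedLMGF hL a₀ θ₀ ha hθ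
  obtain ⟨σ₁, hσ₁, hl⟩ :=
    Summit.AtomisticToContinuum.HydrodynamicLimit.Theorems.CollisionActivityTailsEquilibrium.constantProfileLLN_holds a₀ θ₀ 0 ha hθ
  refine ⟨min σF σ₁, lt_min hσF hσ₁, fun σ hσ hσlt Φ t ht => ?_⟩
  have hσF' : σ < σF := hσlt.trans_le (min_le_left _ _)
  have hσ₁' : σ < σ₁ := hσlt.trans_le (min_le_right _ _)
  obtain ⟨r, hr, hlln⟩ := hl σ hσ hσ₁'
  exact hF σ hσ hσF' (t + 1) (fun _ _ => r) (fun _ _ => θ₀) (fun _ _ => 0)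
    (Summit.AtomisticToContinuum.HydrodynamicLimit.Theorems.DenseExcursionUntied.isHardSphereEulerSolution_const σ (t + 1) 0 hr hθ)
    Φ (hlln Φ) t ⟨ht, by linarith⟩

/-- **Registered helper sub-goal `stub_equilibriumAllStarts`** (line `plaque-thinning-count-ld`): the zero-drift equilibrium rung for every horizon and start,
unconditionally (`equilibriumAllStarts_of_untaggedLMGF`). -/
theorem stub_equilibriumAllStarts : EquilibriumUntaggedActivityLMGF' → ∀ (a₀ θ₀ : ℝ), 0 < a₀ → 0 < θ₀ → ∃ σ₀ : ℝ, 0 < σ₀ ∧ ∀ σ : ℝ, 0 < σ → σ < σ₀ → ∀ (Φ : (N : ℕ) → Flow σ N) (t : ℝ), 0 ≤ t → ∃ V₀ : ℝ, 0 < V₀ ∧ ∀ V : ℝ, V₀ ≤ V → ∀ ε : ℝ, 0 < ε → ∃ τ₀ : ℝ, 0 < τ₀ ∧ ∀ τ : ℝ, τ₀ ≤ τ → ∃ N₀ : ℕ, ∀ N : ℕ, N₀ ≤ N → ∀ s ∈ Set.Icc 0 t, ∫⁻ z, ENNReal.ofReal (((N : ℝ) + 1)⁻¹ * ∑ i : Fin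 (N + 1), tailFn V (act (Φ N) τ s i z)) ∂(localGibbsLaw σ (fun _ => a₀) (fun _ => 0) (fun _ => θ₀) N (Φ N)) ≤ ENNReal.ofReal ε :=
  equilibriumAllStarts_of_untaggedLMGF

end Summit.AtomisticToContinuum.HydrodynamicLimit.Theorems.CollisionActivityTailsEquilibriumRung

end
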